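import Mathlib.Geometry.Euclidean.Angle.Unoriented.Basic
import Mathlib.Analysis.SpecialFunctions.Trigonometric.Inverse
import Literature.Geometry.DiscreteGeometry.GirardSolidAngle
import HarnessLib

/-!
# Euler's formula for the spherical excess in terms of the sides (Euler 1781) — proved

Topic `Literature/Geometry/DiscreteGeometry`; fifth brick on solid angles after
`SphericalWedgeVolume`, `DihedralAngleFraction`, `GirardSolidAngle` (`sol/4π = (Σ dih − π)/4π`)
and `SphericalPolygonArea`.  Girard's theorem expresses the area of a spherical triangle through
its ANGLES; every area ESTIMATE from the side lengths (Leech's and Hales's solid-angle bounds for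
Delaunay triangles of kissing configurations — Hales 2012, Theorem 2, "by Lexell's theorem";
Musin–Tarasov 2012 §4) needs the excess as a function of the SIDES.  This file proves the
classical closed form, in purely algebraic (cosine) form.

For unit vectors `a, b, c` write `x = ⟪b, c⟫, y = ⟪a, c⟫, z = ⟪a, b⟫` (the cosines of the sides
opposite `a, b, c`), `D = 1 − x² − y² − z² + 2xyz` (the Gram determinant) and
`E = ∠A + ∠B + ∠C − π` (`sphExcess a b c`, the angles being the dihedral angles
`∠(perpTo a b, perpTo a c)` … of `GirardSolidAngle.lean`, so that `E = 4π · solidAngleFraction`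
by Girard).

* `sphExcess a b c = ∠A + ∠B + ∠C − π`; `eulerGram x y z = D`, `eulerF x y z = D/((1+x)(1+y)(1+z))`
  with their symmetries and Euler's identity `(1+x+y+z)² + D = 2(1+x)(1+y)(1+z)`
  (`one_add_sq_add_eulerGram`).
* The spherical laws of cosines and sines cleared of denominators (`cos_angle_perpTo_mul`,
  `sin_angle_perpTo_mul`): `cos ∠A · ‖a_b‖‖a_c‖ = x − yz`, `sin ∠A · ‖a_b‖‖a_c‖ = √D`
  (`a_b = perpTo a b`, `‖a_b‖² = 1 − z²`).
* `one_sub_cos_sphExcess` (**Euler's formula**): `1 − cos E = D / ((1+x)(1+y)(1+z))` for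
  linearly independent unit vectors; equivalently `cos² (E/2) = (1+x+y+z)²/(2(1+x)(1+y)(1+z))`,
  i.e. Euler's `cos (E/2) = (1 + cos a + cos b + cos c)/(4 cos ½a cos ½b cos ½c)`.

Everything is PROVED; no named facts.  The sine formula, the regular triangle (`sol₀`), the
link with `solidAngleFraction` and the monotonicity in a side (Lexell) are in the sequel
`SphericalExcessMonotone.lean`; the geometric applications (Hales 2012, Theorem 2) in
`KissingMainEstimate.lean`.

## References
* L. Euler, *De mensura angulorum solidorum*, Acta Acad. Petrop. 2 (1781) 31–54 (the formula
  for `cos (E/2)`); A. J. Lexell, Acta Acad. Petrop. 5 (1784) (the locus of apexes of triangles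
  of given base and area); I. Todhunter, J. G. Leathem, *Spherical Trigonometry* (1914),
  Arts. 102–103. [folklore]
* T. C. Hales, arXiv:1209.6043 (2012), Remark 1 (Lexell) and Theorem 2. [`Hales2012`]
-/

noncomputable section

namespace Literature.Geometry.DiscreteGeometry

open Real RealInnerProductSpace InnerProductGeometry

/-! ### Part A. The excess and Euler's rational function -/

section Defs

variable {F : Type*} [NormedAddCommGroup F] [InnerProductSpace ℝ F]

/-- **The spherical excess** of the triangle with vertices the directions `a, b, c`: the sum of
its three angles — the dihedral angles `∠(perpTo a b, perpTo a c)`, … of the trihedral cone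
`cone(a, b, c)` along its edges — minus `π`.  By Girard's theorem
(`solidAngleFraction_eq_girard`) it is `4π` times the fraction of the unit ball inside the cone,
i.e. the area of the spherical triangle on the unit sphere. [folklore] -/
def sphExcess (a b c : F) : ℝ :=
  angle (perpTo a b) (perpTo a c) + angle (perpTo b a) (perpTo b c) +
    angle (perpTo c a) (perpTo c b) - π

/-- Unfolding `sphExcess`. [folklore] -/
theorem sphExcess_def (a b c : F) : sphExcess a b c =
    angle (perpTo a b) (perpTo a c) + angle (perpTo b a) (perpTo b c) +
      angle (perpTo c a) (perpTo c b) - π := rfl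

end Defs

/-- **The Gram determinant** of three unit vectors with pairwise inner products `x, y, z`:
`det [[1,z,y],[z,1,x],[y,x,1]] = 1 − x² − y² − z² + 2xyz`. [folklore] -/
def eulerGram (x y z : ℝ) : ℝ := 1 - x ^ 2 - y ^ 2 - z ^ 2 + 2 * x * y * z

/-- **Euler's function** `F(x, y, z) = D / ((1+x)(1+y)(1+z))`, the value of `1 − cos E` for a
spherical triangle whose sides have cosines `x, y, z`. [folklore] -/
def eulerF (x y z : ℝ) : ℝ := eulerGram x y z / ((1 + x) * (1 + y) * (1 + z))

/-- Unfolding `eulerGram`. [folklore] -/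
theorem eulerGram_def (x y z : ℝ) :
    eulerGram x y z = 1 - x ^ 2 - y ^ 2 - z ^ 2 + 2 * x * y * z := rfl

/-- Unfolding `eulerF`. [folklore] -/
theorem eulerF_def (x y z : ℝ) :
    eulerF x y z = eulerGram x y z / ((1 + x) * (1 + y) * (1 + z)) := rfl

/-- `eulerGram` is symmetric: swapping the last two arguments. [folklore] -/
theorem eulerGram_swap₂₃ (x y z : ℝ) : eulerGram x z y = eulerGram x y z := by
  unfold eulerGram; ring

/-- `eulerGram` is symmetric: swapping the first two arguments. [folklore] -/
theorem eulerGram_swap₁₂ (x y z : ℝ) : eulerGram y x z = eulerGram x y z := by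
  unfold eulerGram; ring

/-- `eulerF` is symmetric: swapping the last two arguments. [folklore] -/
theorem eulerF_swap₂₃ (x y z : ℝ) : eulerF x z y = eulerF x y z := by
  unfold eulerF; rw [eulerGram_swap₂₃]; ring

/-- `eulerF` is symmetric: swapping the first two arguments. [folklore] -/
theorem eulerF_swap₁₂ (x y z : ℝ) : eulerF y x z = eulerF x y z := by
  unfold eulerF; rw [eulerGram_swap₁₂]; ring

/-- `eulerF` is symmetric: cyclic rotation of the arguments. [folklore] -/
theorem eulerF_rotate (x y z : ℝ) : eulerF y z x = eulerF x y z := by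
  unfold eulerF eulerGram; ring_nf

/-- **Euler's identity** `(1 + x + y + z)² + D = 2 (1+x)(1+y)(1+z)`. [folklore] -/
theorem one_add_sq_add_eulerGram (x y z : ℝ) :
    (1 + x + y + z) ^ 2 + eulerGram x y z = 2 * ((1 + x) * (1 + y) * (1 + z)) := by
  unfold eulerGram; ring

/-! ### Part B. Inner products of the projections `perpTo` for unit vectors -/

section Unit

variable {F : Type*} [NormedAddCommGroup F] [InnerProductSpace ℝ F]

/-- For a unit vector `a`, `perpTo a b = b − ⟪a, b⟫ a`. [folklore] -/
theorem perpTo_of_norm_eq_one {a : F} (ha : ‖a‖ = 1) (b : F) :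
    perpTo a b = b - ⟪a, b⟫ • a := by
  rw [perpTo, real_inner_self_eq_norm_sq, ha, one_pow, div_one]

/-- For a unit vector `a`: `⟪perpTo a b, perpTo a c⟫ = ⟪b, c⟫ − ⟪a, b⟫ ⟪a, c⟫` — the numerator
of the spherical law of cosines. [folklore] -/
theorem inner_perpTo_perpTo_of_norm_eq_one {a : F} (ha : ‖a‖ = 1) (b c : F) :
    ⟪perpTo a b, perpTo a c⟫ = ⟪b, c⟫ - ⟪a, b⟫ * ⟪a, c⟫ := by
  have haa : ⟪a, a⟫ = 1 := by rw [real_inner_self_eq_norm_sq, ha, one_pow]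
  simp only [perpTo_of_norm_eq_one ha, inner_sub_left, inner_sub_right, real_inner_smul_left,
    real_inner_smul_right, haa]
  rw [real_inner_comm a b]
  ring

/-- For unit vectors `a, b`: `‖perpTo a b‖² = 1 − ⟪a, b⟫²`. [folklore] -/
theorem norm_perpTo_sq_of_norm_eq_one {a b : F} (ha : ‖a‖ = 1) (hb : ‖b‖ = 1) :
    ‖perpTo a b‖ ^ 2 = 1 - ⟪a, b⟫ ^ 2 := by
  rw [← real_inner_self_eq_norm_sq, inner_perpTo_perpTo_of_norm_eq_one ha,
    real_inner_self_eq_norm_sq, hb]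
  ring

/-- For unit vectors the two projections along an edge have the same length:
`‖perpTo a b‖ = ‖perpTo b a‖` (both are `sin` of the side `ab`). [folklore] -/
theorem norm_perpTo_comm_of_norm_eq_one {a b : F} (ha : ‖a‖ = 1) (hb : ‖b‖ = 1) :
    ‖perpTo a b‖ = ‖perpTo b a‖ := by
  have h1 := norm_perpTo_sq_of_norm_eq_one ha hb
  have h2 := norm_perpTo_sq_of_norm_eq_one hb ha
  rw [real_inner_comm a b] at h2
  exact (pow_left_inj₀ (norm_nonneg _) (norm_nonneg _) two_ne_zero).1 (h1.trans h2.symm)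

/-- A linearly independent triple gives a linearly independent pair (first two). [folklore] -/
theorem linearIndependent_pair_of_triple₁₂ {a b c : F} (h : LinearIndependent ℝ ![a, b, c]) :
    LinearIndependent ℝ ![a, b] := by
  have hinj : Function.Injective ![(0 : Fin 3), 1] := by
    intro i j hij
    fin_cases i <;> fin_cases j <;> simp_all
  convert h.comp ![(0 : Fin 3), 1] hinj using 1
  ext i : 1
  fin_cases i <;> rfl

/-- A linearly independent triple gives a linearly independent pair (first and third).
[folklore] -/
theorem linearIndependent_pair_of_triple₁₃ {a b c : F} (h : LinearIndependent ℝ ![a, b, c]) :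
    LinearIndependent ℝ ![a, c] := by
  have hinj : Function.Injective ![(0 : Fin 3), 2] := by
    intro i j hij
    fin_cases i <;> fin_cases j <;> simp_all
  convert h.comp ![(0 : Fin 3), 2] hinj using 1
  ext i : 1
  fin_cases i <;> rfl

/-- A linearly independent triple gives a linearly independent pair (last two). [folklore] -/
theorem linearIndependent_pair_of_triple₂₃ {a b c : F} (h : LinearIndependent ℝ ![a, b, c]) :
    LinearIndependent ℝ ![b, c] := by
  have hinj : Function.Injective ![(1 : Fin 3), 2] := by
    intro i j hij
    fin_cases i <;> fin_cases j <;> simp_all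
  convert h.comp ![(1 : Fin 3), 2] hinj using 1
  ext i : 1
  fin_cases i <;> rfl

/-- For linearly independent unit vectors, `⟪a, b⟫² < 1`. [folklore] -/
theorem inner_sq_lt_one_of_linearIndependent {a b : F} (ha : ‖a‖ = 1) (hb : ‖b‖ = 1)
    (h : LinearIndependent ℝ ![a, b]) : ⟪a, b⟫ ^ 2 < 1 := by
  have := inner_sq_lt_of_linearIndependent h
  rwa [real_inner_self_eq_norm_sq, real_inner_self_eq_norm_sq, ha, hb, one_pow, one_mul] at this

/-- The cosine of a (dihedral) angle of the triangle times the two edge-projection lengths: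
`cos ∠A · ‖perpTo a b‖ ‖perpTo a c‖ = ⟪b, c⟫ − ⟪a, b⟫⟪a, c⟫` (spherical law of cosines,
cleared of denominators). [folklore] -/
theorem cos_angle_perpTo_mul {a : F} (ha : ‖a‖ = 1) (b c : F) :
    Real.cos (angle (perpTo a b) (perpTo a c)) * (‖perpTo a b‖ * ‖perpTo a c‖) =
      ⟪b, c⟫ - ⟪a, b⟫ * ⟪a, c⟫ := by
  rw [cos_angle_mul_norm_mul_norm, inner_perpTo_perpTo_of_norm_eq_one ha]

/-- The sine of a (dihedral) angle of the triangle times the two edge-projection lengths is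
`√D` (the "sine theorem" numerator): `sin ∠A · ‖perpTo a b‖ ‖perpTo a c‖ = √D`. [folklore] -/
theorem sin_angle_perpTo_mul {a b c : F} (ha : ‖a‖ = 1) (hb : ‖b‖ = 1) (hc : ‖c‖ = 1) :
    Real.sin (angle (perpTo a b) (perpTo a c)) * (‖perpTo a b‖ * ‖perpTo a c‖) =
      Real.sqrt (eulerGram ⟪b, c⟫ ⟪a, c⟫ ⟪a, b⟫) := by
  rw [sin_angle_mul_norm_mul_norm, real_inner_self_eq_norm_sq, real_inner_self_eq_norm_sq,
    norm_perpTo_sq_of_norm_eq_one ha hb, norm_perpTo_sq_of_norm_eq_one ha hc,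
    inner_perpTo_perpTo_of_norm_eq_one ha]
  congr 1
  unfold eulerGram
  ring

/-- The Gram determinant of three unit vectors is nonnegative (Cauchy–Schwarz for the two
projections `perpTo a b`, `perpTo a c`). [folklore] -/
theorem eulerGram_inner_nonneg {a b c : F} (ha : ‖a‖ = 1) (hb : ‖b‖ = 1) (hc : ‖c‖ = 1) :
    0 ≤ eulerGram ⟪b, c⟫ ⟪a, c⟫ ⟪a, b⟫ := by
  have hcs := real_inner_mul_inner_self_le (perpTo a b) (perpTo a c)
  rw [real_inner_self_eq_norm_sq, real_inner_self_eq_norm_sq,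
    norm_perpTo_sq_of_norm_eq_one ha hb, norm_perpTo_sq_of_norm_eq_one ha hc,
    inner_perpTo_perpTo_of_norm_eq_one ha] at hcs
  have : eulerGram ⟪b, c⟫ ⟪a, c⟫ ⟪a, b⟫ =
      (1 - ⟪a, b⟫ ^ 2) * (1 - ⟪a, c⟫ ^ 2) -
        (⟪b, c⟫ - ⟪a, b⟫ * ⟪a, c⟫) * (⟪b, c⟫ - ⟪a, b⟫ * ⟪a, c⟫) := by
    unfold eulerGram; ring
  rw [this]
  linarith

/-! ### Part C. Euler's formula -/

/-- **Euler's formula for the spherical excess (1781), cosine form.**  For linearly independent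
unit vectors `a, b, c` with `x = ⟪b, c⟫, y = ⟪a, c⟫, z = ⟪a, b⟫` (the cosines of the sides)
and `D = 1 − x² − y² − z² + 2xyz`:
`1 − cos E = D / ((1 + x)(1 + y)(1 + z))`, where `E = sphExcess a b c` is the excess
(angle sum minus `π`, the area of the spherical triangle).  Equivalent to Euler's
`cos (E/2) = (1 + cos a + cos b + cos c) / (4 cos ½a cos ½b cos ½c)` squared, by
`(1 + x + y + z)² + D = 2(1+x)(1+y)(1+z)`.  Proof: expand `cos (A + B + C)` and insert the
spherical laws of cosines and sines `cos A = (x − yz)/(‖a_b‖‖a_c‖)`, `sin A = √D/(‖a_b‖‖a_c‖)`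
(`a_b = perpTo a b`), `‖a_b‖ = ‖b_a‖ = √(1 − z²)`; the resulting polynomial identity is
`(1−x²)(1−y²)(1−z²) + (x−yz)(y−xz)(z−xy) − D((x−yz)+(y−xz)+(z−xy)) = D(1−x)(1−y)(1−z)`.
[folklore] -/
theorem one_sub_cos_sphExcess {a b c : F} (ha : ‖a‖ = 1) (hb : ‖b‖ = 1) (hc : ‖c‖ = 1)
    (hli : LinearIndependent ℝ ![a, b, c]) :
    1 - Real.cos (sphExcess a b c) = eulerF ⟪b, c⟫ ⟪a, c⟫ ⟪a, b⟫ := by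
  -- notation
  set x := ⟪b, c⟫ with hx
  set y := ⟪a, c⟫ with hy
  set z := ⟪a, b⟫ with hz
  set A := angle (perpTo a b) (perpTo a c) with hA
  set B := angle (perpTo b a) (perpTo b c) with hB
  set C := angle (perpTo c a) (perpTo c b) with hC
  -- the pairwise inner products are `< 1` in absolute value
  have hz1 : z ^ 2 < 1 :=
    inner_sq_lt_one_of_linearIndependent ha hb (linearIndependent_pair_of_triple₁₂ hli)
  have hy1 : y ^ 2 < 1 :=
    inner_sq_lt_one_of_linearIndependent ha hc (linearIndependent_pair_of_triple₁₃ hli)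
  have hx1 : x ^ 2 < 1 :=
    inner_sq_lt_one_of_linearIndependent hb hc (linearIndependent_pair_of_triple₂₃ hli)
  have hxb := abs_lt.1 ((sq_lt_one_iff_abs_lt_one x).1 hx1)
  have hyb := abs_lt.1 ((sq_lt_one_iff_abs_lt_one y).1 hy1)
  have hzb := abs_lt.1 ((sq_lt_one_iff_abs_lt_one z).1 hz1)
  -- the six projection lengths
  set nab := ‖perpTo a b‖ with hnab
  set nac := ‖perpTo a c‖ with hnac
  set nbc := ‖perpTo b c‖ with hnbc
  have eba : ‖perpTo b a‖ = nab := (norm_perpTo_comm_of_norm_eq_one ha hb).symm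
  have eca : ‖perpTo c a‖ = nac := (norm_perpTo_comm_of_norm_eq_one ha hc).symm
  have ecb : ‖perpTo c b‖ = nbc := (norm_perpTo_comm_of_norm_eq_one hb hc).symm
  have sab : nab ^ 2 = 1 - z ^ 2 := norm_perpTo_sq_of_norm_eq_one ha hb
  have sac : nac ^ 2 = 1 - y ^ 2 := norm_perpTo_sq_of_norm_eq_one ha hc
  have sbc : nbc ^ 2 = 1 - x ^ 2 := norm_perpTo_sq_of_norm_eq_one hb hc
  -- the Gram determinant and its square root
  set D := eulerGram x y z with hD
  have hD0 : 0 ≤ D := eulerGram_inner_nonneg ha hb hc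
  set r := Real.sqrt D with hr
  have hrr : r * r = D := Real.mul_self_sqrt hD0
  -- laws of cosines and sines at the three vertices
  have cA : Real.cos A * (nab * nac) = x - z * y := by
    rw [hA, cos_angle_perpTo_mul ha]
  have sA : Real.sin A * (nab * nac) = r := by
    rw [hA, sin_angle_perpTo_mul ha hb hc]
  have cB : Real.cos B * (nab * nbc) = y - z * x := by
    rw [hB, ← eba, cos_angle_perpTo_mul hb, real_inner_comm a b]
  have sB : Real.sin B * (nab * nbc) = r := by
    rw [hB, ← eba, sin_angle_perpTo_mul hb ha hc, real_inner_comm a b, hr, hD,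
      eulerGram_swap₁₂]
  have cC : Real.cos C * (nac * nbc) = z - y * x := by
    rw [hC, ← eca, ← ecb, cos_angle_perpTo_mul hc, real_inner_comm a c, real_inner_comm b c]
  have sC : Real.sin C * (nac * nbc) = r := by
    rw [hC, ← eca, ← ecb, sin_angle_perpTo_mul hc ha hb, real_inner_comm a c,
      real_inner_comm b c, hr, hD,
      show eulerGram z x y = eulerGram x y z by unfold eulerGram; ring]
  -- `cos E = -cos (A + B + C)`, expanded
  have hE : sphExcess a b c = A + B + C - π := by rw [hA, hB, hC, sphExcess]
  have hcosE : Real.cos (sphExcess a b c) =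
      -(Real.cos A * Real.cos B * Real.cos C - Real.cos A * Real.sin B * Real.sin C -
        Real.sin A * Real.cos B * Real.sin C - Real.sin A * Real.sin B * Real.cos C) := by
    rw [hE, Real.cos_sub_pi, Real.cos_add, Real.cos_add, Real.sin_add]
    ring
  -- multiply through by `N = (nab nac)(nab nbc)(nac nbc) = (1-z²)(1-y²)(1-x²)`
  have hN : (nab * nac) * (nab * nbc) * (nac * nbc) = (1 - z ^ 2) * (1 - y ^ 2) * (1 - x ^ 2) := by
    rw [← sab, ← sac, ← sbc]; ring
  have key : (1 - Real.cos (sphExcess a b c)) * ((1 - z ^ 2) * (1 - y ^ 2) * (1 - x ^ 2)) =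
      D * ((1 - x) * (1 - y) * (1 - z)) := by
    rw [hcosE, ← hN]
    have e1 : (1 - -(Real.cos A * Real.cos B * Real.cos C - Real.cos A * Real.sin B * Real.sin C -
          Real.sin A * Real.cos B * Real.sin C - Real.sin A * Real.sin B * Real.cos C)) *
          ((nab * nac) * (nab * nbc) * (nac * nbc)) =
        (nab * nac) * (nab * nbc) * (nac * nbc) +
          (Real.cos A * (nab * nac)) * (Real.cos B * (nab * nbc)) * (Real.cos C * (nac * nbc)) -
          (Real.cos A * (nab * nac)) * (Real.sin B * (nab * nbc)) * (Real.sin C * (nac * nbc)) -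
          (Real.sin A * (nab * nac)) * (Real.cos B * (nab * nbc)) * (Real.sin C * (nac * nbc)) -
          (Real.sin A * (nab * nac)) * (Real.sin B * (nab * nbc)) * (Real.cos C * (nac * nbc)) := by
      ring
    rw [e1, cA, sA, cB, sB, cC, sC, hN]
    have hD' : D = 1 - x ^ 2 - y ^ 2 - z ^ 2 + 2 * x * y * z := by rw [hD, eulerGram]
    linear_combination (-((x - z * y) + (y - z * x) + (z - y * x))) * hrr +
      (-((x - z * y) + (y - z * x) + (z - y * x) + (1 - x) * (1 - y) * (1 - z))) * hD'
  -- divide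
  have hQ : 0 < (1 + x) * (1 + y) * (1 + z) :=
    mul_pos (mul_pos (by linarith) (by linarith)) (by linarith)
  have hQ' : 0 < (1 - x) * (1 - y) * (1 - z) :=
    mul_pos (mul_pos (by linarith) (by linarith)) (by linarith)
  have e2 : (1 - z ^ 2) * (1 - y ^ 2) * (1 - x ^ 2) =
      ((1 + x) * (1 + y) * (1 + z)) * ((1 - x) * (1 - y) * (1 - z)) := by ring
  rw [e2, ← mul_assoc] at key
  have key' := mul_right_cancel₀ hQ'.ne' key
  rw [eulerF, ← hD, eq_div_iff hQ.ne']
  exact key'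

end Unit

end Literature.Geometry.DiscreteGeometry

end
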